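import Mathlib
import Literature.Probability.LatticeModels.BrillouinRiemannSumRate

/-!
# Riemann sums over the momentum grid of the torus: the TWO-VOLUME comparison with explicit rate

Topic `Probability/LatticeModels`; companion of `BrillouinRiemannSumRate.lean`
(`norm_momentumAverage_sub_integral_le_div`: `‖L^{-d} Σ_k G(2πk/L) - (2π)^{-d}∫ G‖ ≤ 2πK/L` for a
`K`-Lipschitz integrand, every side `L ≥ 1`).  Two-volume statements of finite-volume lattice
perturbation theory («the volume-`L` value is within `ρ(L)` of every later volume's value, up to a
modulus in the external momentum», e.g. the rate-form volume slot `TwoLegVolumeRate` and the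
two-volume-rate stub of the volume-limit child of the Hubbard KL programme,
`Summits/HubbardSuperconductivity/…/KLProgrammeKLRegimeVolumeLimitCauchy[Termwise]`) compare momentum
averages at two sides `L ≤ L′` of two nearby integrands (the same integrand read at two external
momenta).  PROVED here, for functions with values in any real Banach space:

* `volume_real_brillouin` — `vol [-π,π]^d = (2π)^d` (the zone-average normalisation);
* `norm_zoneAverage_sub_zoneAverage_le` — zone averages of two integrands that differ by `≤ δ` on
  `[0,2π]^d` differ by `≤ δ`;
* `norm_momentumAverage_sub_momentumAverage_le` — **for `G`, `G′` Lipschitz (`K`, `K′`) on `[0,2π]^d`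
  with `‖G - G′‖ ≤ δ` there: `‖L^{-d} Σ_k G(2πk/L) - L′^{-d} Σ_{k′} G′(2πk′/L′)‖ ≤ 2πK/L + 2πK′/L′ + δ`**
  for all sides `L, L′ ≥ 1`;
* `norm_momentumAverage_two_volumes_le` — the same integrand at two volumes: `≤ 2πK/L + 2πK/L′`.

Everything is proved; no definitions. [folklore]

## Mathlib / tree search

`lean search 'momentumAverage_sub|two_volumes|twoVolume'` — only the one-volume rates of
`BrillouinRiemannSumRate` and the qualitative/compact-uniform statements of `BrillouinRiemannSum*`.
Used: `norm_setIntegral_le_of_norm_le_const`, `Real.volume_Icc_pi_toReal`, `integral_sub`.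

## References

* S. Friedli, Y. Velenik, *Statistical Mechanics of Lattice Systems* (CUP 2017), §10.5.2, (10.41)
  (momentum sums of the torus as Riemann sums over the Brillouin zone). [FriedliVelenikSMLS2017]
* W. Rudin, *Principles of Mathematical Analysis*, 3rd ed., Thm. 6.8 / 6.10. [Rudin1976]
-/

noncomputable section

namespace Literature.Probability.LatticeModels

open MeasureTheory Finset Real
open scoped NNReal

variable {d : ℕ} {E : Type*} [NormedAddCommGroup E] [NormedSpace ℝ E] [CompleteSpace E]

/-- The Brillouin zone `[-π,π]^d` has volume `(2π)^d` (the normalisation of zone averages `(2π)^{-d}∫_{[-π,π]^d}`).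
[cite: FriedliVelenikSMLS2017, §10.5.2 (10.41)] -/
theorem volume_real_brillouin : (volume : Measure (Fin d → ℝ)).real (brillouin d) = (2 * π) ^ d := by
  have hle : (fun _ : Fin d => -π) ≤ (fun _ : Fin d => π) := fun _ => by
    simp only; linarith [Real.pi_pos]
  rw [measureReal_def, brillouin, Set.pi_univ_Icc, Real.volume_Icc_pi_toReal hle]
  simp only [sub_neg_eq_add, Finset.prod_const, Finset.card_univ, Fintype.card_fin]
  ring

/-- Translation by `(π,…,π)` maps the zone `[-π,π]^d` into `[0,2π]^d`. [folklore] -/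
private theorem add_pi_mem_cube_of_mem_brillouin {q : Fin d → ℝ} (hq : q ∈ brillouin d) :
    (fun i => q i + π) ∈ Set.pi Set.univ fun _ : Fin d => Set.Icc (0 : ℝ) (2 * π) := by
  intro i _
  obtain ⟨h1, h2⟩ := hq i (Set.mem_univ i)
  constructor <;> linarith

omit [CompleteSpace E] in
/-- **Zone averages of nearby integrands.** If `G`, `G′` are integrable on the shifted zone and
`‖G q - G′ q‖ ≤ δ` on `[0,2π]^d`, then
`‖(2π)^{-d}∫_{[-π,π]^d} G(q+π) dq - (2π)^{-d}∫_{[-π,π]^d} G′(q+π) dq‖ ≤ δ` (zone averages are normalised integrals over a set of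
volume `(2π)^d`). [cite: FriedliVelenikSMLS2017, §10.5.2 (10.41)] -/
theorem norm_zoneAverage_sub_zoneAverage_le {G G' : (Fin d → ℝ) → E}
    (hGi : IntegrableOn (fun q : Fin d → ℝ => G (fun i => q i + π)) (brillouin d))
    (hG'i : IntegrableOn (fun q : Fin d → ℝ => G' (fun i => q i + π)) (brillouin d)) {δ : ℝ}
    (hGG' : ∀ q ∈ Set.pi Set.univ fun _ : Fin d => Set.Icc (0 : ℝ) (2 * π), ‖G q - G' q‖ ≤ δ) :
    ‖((2 * π) ^ d)⁻¹ • (∫ q in brillouin d, G (fun i => q i + π)) -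
        ((2 * π) ^ d)⁻¹ • (∫ q in brillouin d, G' (fun i => q i + π))‖ ≤ δ := by
  have h2π : (0 : ℝ) < (2 * π) ^ d := by positivity
  rw [← smul_sub, ← integral_sub hGi hG'i, norm_smul, norm_inv, Real.norm_of_nonneg h2π.le,
    inv_mul_le_iff₀ h2π]
  have h := norm_setIntegral_le_of_norm_le_const (μ := (volume : Measure (Fin d → ℝ)))
    (f := fun q : Fin d → ℝ => G (fun i => q i + π) - G' (fun i => q i + π)) (isCompact_brillouin d).measure_lt_top
    (fun q hq => hGG' _ (add_pi_mem_cube_of_mem_brillouin hq))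
  rw [volume_real_brillouin] at h
  calc ‖∫ q in brillouin d, (G (fun i => q i + π) - G' (fun i => q i + π))‖ ≤ δ * (2 * π) ^ d := h
    _ = (2 * π) ^ d * δ := by ring

omit [NormedSpace ℝ E] [CompleteSpace E] in
/-- A function Lipschitz on `[0,2π]^d` is integrable on the shifted zone. [folklore] -/
private theorem integrableOn_shift_of_lipschitzOnWith {G : (Fin d → ℝ) → E} {K : ℝ≥0}
    (hG : LipschitzOnWith K G (Set.pi Set.univ fun _ : Fin d => Set.Icc (0 : ℝ) (2 * π))) :
    IntegrableOn (fun q : Fin d → ℝ => G (fun i => q i + π)) (brillouin d) := by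
  refine ContinuousOn.integrableOn_compact (isCompact_brillouin d) ?_
  refine hG.continuousOn.comp (Continuous.continuousOn ?_) fun q hq => add_pi_mem_cube_of_mem_brillouin hq
  exact continuous_pi fun i => (continuous_apply i).add continuous_const

/-- **Two-volume comparison of momentum averages, explicit rate.** For `G`, `G′` Lipschitz on `[0,2π]^d`
(constants `K`, `K′`, sup metric) with `‖G q - G′ q‖ ≤ δ` there, and all sides `L, L′ ≥ 1`:
`‖L^{-d} Σ_{k ∈ (ℤ/L)^d} G(2πk/L) - L′^{-d} Σ_{k′ ∈ (ℤ/L′)^d} G′(2πk′/L′)‖ ≤ 2πK/L + 2πK′/L′ + δ`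
(both averages are within `2πK/L`, `2πK′/L′` of the zone averages, which differ by `≤ δ`).  The shape
consumed termwise by two-volume-rate statements: `G = F(p,·)`, `G′ = F(p′,·)` with `δ` the modulus of
`F` in the external momentum. [cite: FriedliVelenikSMLS2017, §10.5.2 (10.41)] -/
theorem norm_momentumAverage_sub_momentumAverage_le {L L' : ℕ} [NeZero L] [NeZero L']
    {G G' : (Fin d → ℝ) → E} {K K' : ℝ≥0}
    (hG : LipschitzOnWith K G (Set.pi Set.univ fun _ : Fin d => Set.Icc (0 : ℝ) (2 * π)))
    (hG' : LipschitzOnWith K' G' (Set.pi Set.univ fun _ : Fin d => Set.Icc (0 : ℝ) (2 * π)))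
    {δ : ℝ} (hGG' : ∀ q ∈ Set.pi Set.univ fun _ : Fin d => Set.Icc (0 : ℝ) (2 * π), ‖G q - G' q‖ ≤ δ) :
    ‖((L ^ d : ℕ) : ℝ)⁻¹ • ∑ k : TorusSite d L, G (latticeMomentum L k) -
        ((L' ^ d : ℕ) : ℝ)⁻¹ • ∑ k : TorusSite d L', G' (latticeMomentum L' k)‖ ≤
      2 * π * K / L + 2 * π * K' / L' + δ := by
  set A : E := ((L ^ d : ℕ) : ℝ)⁻¹ • ∑ k : TorusSite d L, G (latticeMomentum L k) with hA
  set A' : E := ((L' ^ d : ℕ) : ℝ)⁻¹ • ∑ k : TorusSite d L', G' (latticeMomentum L' k) with hA'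
  set I : E := ((2 * π) ^ d)⁻¹ • ∫ q in brillouin d, G (fun i => q i + π) with hI
  set I' : E := ((2 * π) ^ d)⁻¹ • ∫ q in brillouin d, G' (fun i => q i + π) with hI'
  have h1 : ‖A - I‖ ≤ 2 * π * K / L := norm_momentumAverage_sub_integral_le_div (L := L) hG
  have h2 : ‖A' - I'‖ ≤ 2 * π * K' / L' := norm_momentumAverage_sub_integral_le_div (L := L') hG'
  have h3 : ‖I - I'‖ ≤ δ := norm_zoneAverage_sub_zoneAverage_le (integrableOn_shift_of_lipschitzOnWith hG)
    (integrableOn_shift_of_lipschitzOnWith hG') hGG'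
  calc ‖A - A'‖ = ‖(A - I) + (I - I') - (A' - I')‖ := by congr 1; abel
    _ ≤ ‖(A - I) + (I - I')‖ + ‖A' - I'‖ := norm_sub_le _ _
    _ ≤ ‖A - I‖ + ‖I - I'‖ + ‖A' - I'‖ := by gcongr; exact norm_add_le _ _
    _ ≤ 2 * π * K / L + δ + 2 * π * K' / L' := add_le_add_three h1 h3 h2
    _ = 2 * π * K / L + 2 * π * K' / L' + δ := by ring

/-- **The same integrand at two volumes**: for `G` `K`-Lipschitz on `[0,2π]^d` and all sides `L, L′ ≥ 1`,
`‖L^{-d} Σ_k G(2πk/L) - L′^{-d} Σ_{k′} G(2πk′/L′)‖ ≤ 2πK/L + 2πK/L′`. [cite: FriedliVelenikSMLS2017, §10.5.2 (10.41)] -/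
theorem norm_momentumAverage_two_volumes_le {L L' : ℕ} [NeZero L] [NeZero L']
    {G : (Fin d → ℝ) → E} {K : ℝ≥0}
    (hG : LipschitzOnWith K G (Set.pi Set.univ fun _ : Fin d => Set.Icc (0 : ℝ) (2 * π))) :
    ‖((L ^ d : ℕ) : ℝ)⁻¹ • ∑ k : TorusSite d L, G (latticeMomentum L k) -
        ((L' ^ d : ℕ) : ℝ)⁻¹ • ∑ k : TorusSite d L', G (latticeMomentum L' k)‖ ≤
      2 * π * K / L + 2 * π * K / L' := by
  have h := norm_momentumAverage_sub_momentumAverage_le (L := L) (L' := L') hG hG (δ := 0)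
    (fun q _ => by simp)
  simpa using h

end Literature.Probability.LatticeModels
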